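import Summits.CriticalPhenomena.PercolationContinuityZ3.Theorems.PercNearOneGluingNoHeavyLowerTailPathExchange
import HarnessLib

/-!
# The crossing-to-pendant exchange inequality of the `Q44b` programme (all `n`, all weights)

Support file for crux `stmt-CriticalPhenomena-4575` (`NoHeavyLowerTail`; master-family programme, the quadratic
four-point row `Q44b` of `prim-bnk-1` gen 13, OPEN for all `n`), seat `prim-l12-p6` gen 7; memo
`run/shared/lean/prim/prim-l12/FROM-prim-l12-p6-g7-Q44B-PENCIL-CONCAVITY.md`.

Bond percolation `μ = prodBernoulli w` with arbitrary edge weights on a finite vertex type, four vertices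
`a b c y`; write `P(π)` for the probability that the open clusters induce the partition `π` of `{a,b,c,y}`.
This file proves, for EVERY finite weighted graph,

* `crossPendant_exchange`:   `P(a|b|cy) · P(ac|by) ≤ P(a|bcy) · P(ac|b|y)`,
* `crossPendant_exchange'`:  `P(a|b|cy) · P(ay|bc) ≤ P(a|bcy) · P(ay|b|c)` (the `c ↔ y` mirror),
* `crossPendant_exchange_sum`: `P(a|b|cy) · [P(ac|by) + P(ay|bc)] ≤ P(a|bcy) · [P(ac|b|y) + P(ay|b|c)]`,

i.e. `P(a|b|cy)·P(X) ≤ P(a|bcy)·P(X′)` for the two cell families `X = {ac|by, ay|bc}` (the 'crossings') and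
`X′ = {ac|b|y, ay|b|c}` of the row `Q44b`.  Role in the programme (memo §2–§3): `Q44b` for all graphs follows
from the CONCAVITY of `Q44b` along the one-bond pencil of every edge at the terminal `a` ('ND_a', a 5-point
inequality, numerically exact on > 10⁴ instances); along the pencil of the edge `{a,b}` that concavity is
literally `crossPendant_exchange_sum`, so this file proves the `y = b` case of `ND_a`.

Proof (`crossPendant_exchange`): two instances of the set form of van den Berg–Häggström–Kahn's two-cluster
conditional association (`setClusterEventExchange`):
(A) given `{a} ↮ {b,c,y}` the increasing events `{b~y}`, `{c~y}` (functions of `C_{b,c,y}`) are positively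
    correlated: `μ(D₀∩by)·μ(D₀∩cy) ≤ μ(D₀∩by∩cy)·μ(D₀)`;
(B) given `{a} ↮ {b,y}` the events `{a~c}` (a function of `C_a`) and `{b~y}` (a function of `C_{b,y}`) are
    negatively correlated: `μ(D∩ac∩by)·μ(D) ≤ μ(D∩ac)·μ(D∩by)`;
and the bookkeeping `D₀ = D ∖ {a~c}`, `P(a|b|cy) = μ(D₀∩cy) − μ(D₀∩by∩cy)`, `P(ac|b|y) = μ(D∩ac) − μ(D∩ac∩by)`.
Theorems only (no definitions, no named facts); standard axioms.
-/

namespace Summit.CriticalPhenomena.PercolationContinuityZ3.Theorems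

namespace Q44bExchange

open MeasureTheory Set
open Literature.Probability.LatticeModels (prodBernoulli)
open Literature.Probability.Percolation

variable {V : Type*}

/-- `{ω | u ↔ v inside C_S(ω)} = {u ↔ v}` for `u ∈ S` (event form of the tree's `PathExchange.reachIn_biUnion_iff`:
every edge of an open path from `u` lies in `C_u ⊆ C_S`). [folklore] -/
theorem setOf_fromEdgeSet_biUnion_reachable (S : Set V) {u : V} (hu : u ∈ S) (v : V) :
    {ω : BondConfig V | (SimpleGraph.fromEdgeSet (⋃ s ∈ S, openEdgeCluster ω s)).Reachable u v} =
      openConn u v := by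
  ext ω
  exact PathExchange.reachIn_biUnion_iff ω S u v hu

variable [Fintype V]

/-- **Step (A)**: given `{a} ↮ {b,c,y}`, the events `{b~y}` and `{c~y}` are positively correlated:
`μ(D₀ ∩ by) · μ(D₀ ∩ cy) ≤ μ(D₀ ∩ by ∩ cy) · μ(D₀)` with `D₀ = {a≁b} ∩ {a≁c} ∩ {a≁y}` (BHK 2006, Thm. 1.3 with the
vertex set `{b,c,y}`). [cite: VandenbergHaggstromKahn2005, Thm. 2.1 (p. 9) at q = 1 — corollary] -/
theorem stepA (w : Sym2 V → unitInterval) (a b c y : V) :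
    (prodBernoulli w).real ((openConn a b)ᶜ ∩ (openConn a c)ᶜ ∩ (openConn a y)ᶜ ∩ openConn b y) *
        (prodBernoulli w).real ((openConn a b)ᶜ ∩ (openConn a c)ᶜ ∩ (openConn a y)ᶜ ∩ openConn c y) ≤
      (prodBernoulli w).real ((openConn a b)ᶜ ∩ (openConn a c)ᶜ ∩ (openConn a y)ᶜ ∩
          (openConn b y ∩ openConn c y)) *
        (prodBernoulli w).real ((openConn a b)ᶜ ∩ (openConn a c)ᶜ ∩ (openConn a y)ᶜ) := by
  classical
  have hb : b ∈ ({b, c, y} : Set V) := by simp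
  have hc : c ∈ ({b, c, y} : Set V) := by simp
  have key := setClusterEventExchange w ({b, c, y} : Set V) ({a} : Set V)
    (fun C => (SimpleGraph.fromEdgeSet C).Reachable b y) (fun C => (SimpleGraph.fromEdgeSet C).Reachable c y)
    (fun _ => True) (fun _ => True)
    (PathExchange.reachIn_mono b y) (PathExchange.reachIn_mono c y)
    (fun _ _ _ h => h) (fun _ _ _ h => h)
  have hD : {ω : BondConfig V | ∀ s ∈ ({b, c, y} : Set V), ∀ t ∈ ({a} : Set V),
      ¬ (openGraph ω).Reachable s t} = (openConn a b)ᶜ ∩ (openConn a c)ᶜ ∩ (openConn a y)ᶜ := by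
    ext ω
    simp only [mem_setOf_eq, mem_insert_iff, mem_singleton_iff, forall_eq_or_imp, forall_eq,
      mem_inter_iff, mem_compl_iff, openConn, mem_setOf_eq]
    constructor
    · rintro ⟨h1, h2, h3⟩
      exact ⟨⟨fun h => h1 h.symm, fun h => h2 h.symm⟩, fun h => h3 h.symm⟩
    · rintro ⟨⟨h1, h2⟩, h3⟩
      exact ⟨fun h => h1 h.symm, fun h => h2 h.symm, fun h => h3 h.symm⟩
  simp only [setOf_fromEdgeSet_biUnion_reachable _ hb, setOf_fromEdgeSet_biUnion_reachable _ hc,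
    setOf_true, inter_univ, hD] at key
  exact key

/-- **Step (B)**: given `{a} ↮ {b,y}`, the events `{a~c}` and `{b~y}` are negatively correlated:
`μ(D ∩ ac ∩ by) · μ(D) ≤ μ(D ∩ ac) · μ(D ∩ by)` with `D = {a≁b} ∩ {a≁y}` (BHK 2006, Thm. 1.4 with the vertex sets
`{a}`, `{b,y}`). [cite: VandenbergHaggstromKahn2005, Thm. 2.1 (p. 9) at q = 1 — corollary] -/
theorem stepB (w : Sym2 V → unitInterval) (a b c y : V) :
    (prodBernoulli w).real ((openConn a b)ᶜ ∩ (openConn a y)ᶜ ∩ (openConn a c ∩ openConn b y)) *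
        (prodBernoulli w).real ((openConn a b)ᶜ ∩ (openConn a y)ᶜ) ≤
      (prodBernoulli w).real ((openConn a b)ᶜ ∩ (openConn a y)ᶜ ∩ openConn a c) *
        (prodBernoulli w).real ((openConn a b)ᶜ ∩ (openConn a y)ᶜ ∩ openConn b y) := by
  classical
  have ha : a ∈ ({a} : Set V) := by simp
  have hb : b ∈ ({b, y} : Set V) := by simp
  have key := setClusterEventExchange w ({a} : Set V) ({b, y} : Set V)
    (fun C => (SimpleGraph.fromEdgeSet C).Reachable a c) (fun _ => True)
    (fun C => (SimpleGraph.fromEdgeSet C).Reachable b y) (fun _ => True)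
    (PathExchange.reachIn_mono a c) (fun _ _ _ h => h)
    (PathExchange.reachIn_mono b y) (fun _ _ _ h => h)
  have hD : {ω : BondConfig V | ∀ s ∈ ({a} : Set V), ∀ t ∈ ({b, y} : Set V),
      ¬ (openGraph ω).Reachable s t} = (openConn a b)ᶜ ∩ (openConn a y)ᶜ := by
    ext ω
    simp only [mem_setOf_eq, mem_insert_iff, mem_singleton_iff, forall_eq_or_imp, forall_eq,
      mem_inter_iff, mem_compl_iff, openConn, mem_setOf_eq]
  simp only [setOf_fromEdgeSet_biUnion_reachable _ ha, setOf_fromEdgeSet_biUnion_reachable _ hb,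
    setOf_true, inter_univ, hD] at key
  exact key

/-- **Crossing-to-pendant exchange (all `n`, all weights).**  For `μ = prodBernoulli w` and vertices `a b c y`:
`P(a|b|cy) · P(ac|by) ≤ P(a|bcy) · P(ac|b|y)`, the cells written as intersections of connection events and
their complements (`a|b|cy = {a≁b,a≁c,a≁y, c~y, b≁y}`, `ac|by = {a≁b,a≁y, a~c, b~y}`, `a|bcy = {a≁b,a≁c,a≁y, b~y, c~y}`,
`ac|b|y = {a≁b,a≁y, a~c, b≁y}`; the omitted literals are implied).  Proof: steps (A), (B) and bookkeeping.
[this work] -/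
theorem crossPendant_exchange (w : Sym2 V → unitInterval) (a b c y : V) :
    (prodBernoulli w).real ((openConn a b)ᶜ ∩ (openConn a c)ᶜ ∩ (openConn a y)ᶜ ∩ openConn c y ∩
          (openConn b y)ᶜ) *
        (prodBernoulli w).real ((openConn a b)ᶜ ∩ (openConn a y)ᶜ ∩ openConn a c ∩ openConn b y) ≤
      (prodBernoulli w).real ((openConn a b)ᶜ ∩ (openConn a c)ᶜ ∩ (openConn a y)ᶜ ∩ openConn b y ∩
          openConn c y) *
        (prodBernoulli w).real ((openConn a b)ᶜ ∩ (openConn a y)ᶜ ∩ openConn a c ∩ (openConn b y)ᶜ) := by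
  classical
  set μ := prodBernoulli w with hμ
  -- the sets
  set D0 : Set (BondConfig V) := (openConn a b)ᶜ ∩ (openConn a c)ᶜ ∩ (openConn a y)ᶜ with hD0
  set D : Set (BondConfig V) := (openConn a b)ᶜ ∩ (openConn a y)ᶜ with hD
  set By : Set (BondConfig V) := openConn b y with hBy
  set Cy : Set (BondConfig V) := openConn c y with hCy
  set Ac : Set (BondConfig V) := openConn a c with hAc
  have hA := stepA w a b c y
  have hB := stepB w a b c y
  simp only [← hμ, ← hD0, ← hD, ← hBy, ← hCy, ← hAc] at hA hB
  -- real numbers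
  set δ0 := μ.real D0 with hδ0
  set mby0 := μ.real (D0 ∩ By)
  set mcy := μ.real (D0 ∩ Cy)
  set mbcy := μ.real (D0 ∩ (By ∩ Cy))
  set δ := μ.real D
  set γ := μ.real (D ∩ Ac)
  set mbyD := μ.real (D ∩ By)
  set α := μ.real (D ∩ (Ac ∩ By))
  -- measurability is automatic on the finite configuration space
  have hmeas : ∀ s : Set (BondConfig V), MeasurableSet s := fun _ => MeasurableSet.of_discrete
  -- bookkeeping identities
  have e1 : δ = γ + δ0 := by
    have h := measureReal_inter_add_sdiff (μ := μ) (s := D) (hmeas Ac)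
    have hset : D \ Ac = D0 := by
      ext ω; simp only [hD, hD0, mem_sdiff, mem_inter_iff, mem_compl_iff]; tauto
    rw [hset] at h
    linarith
  have e2 : mbyD = α + mby0 := by
    have h := measureReal_inter_add_sdiff (μ := μ) (s := D ∩ By) (hmeas Ac)
    have hset1 : D ∩ By ∩ Ac = D ∩ (Ac ∩ By) := by
      ext ω; simp only [mem_inter_iff]; tauto
    have hset2 : (D ∩ By) \ Ac = D0 ∩ By := by
      ext ω; simp only [hD, hD0, mem_sdiff, mem_inter_iff, mem_compl_iff]; tauto
    rw [hset1, hset2] at h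
    linarith
  have e3 : μ.real (D0 ∩ Cy ∩ Byᶜ) = mcy - mbcy := by
    have h := measureReal_inter_add_sdiff (μ := μ) (s := D0 ∩ Cy) (hmeas By)
    have hset1 : D0 ∩ Cy ∩ By = D0 ∩ (By ∩ Cy) := by
      ext ω; simp only [mem_inter_iff]; tauto
    have hset2 : (D0 ∩ Cy) \ By = D0 ∩ Cy ∩ Byᶜ := by
      ext ω; simp only [mem_sdiff, mem_inter_iff, mem_compl_iff]
    rw [hset1, hset2] at h
    linarith
  have e4 : μ.real (D ∩ Ac ∩ Byᶜ) = γ - α := by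
    have h := measureReal_inter_add_sdiff (μ := μ) (s := D ∩ Ac) (hmeas By)
    have hset1 : D ∩ Ac ∩ By = D ∩ (Ac ∩ By) := by
      ext ω; simp only [mem_inter_iff]; tauto
    have hset2 : (D ∩ Ac) \ By = D ∩ Ac ∩ Byᶜ := by
      ext ω; simp only [mem_sdiff, mem_inter_iff, mem_compl_iff]
    rw [hset1, hset2] at h
    linarith
  have e5 : μ.real (D0 ∩ By ∩ Cy) = mbcy := by
    have hset : D0 ∩ By ∩ Cy = D0 ∩ (By ∩ Cy) := by
      ext ω; simp only [mem_inter_iff]; tauto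
    rw [hset]
  have e6 : μ.real (D ∩ Ac ∩ By) = α := by
    have hset : D ∩ Ac ∩ By = D ∩ (Ac ∩ By) := by
      ext ω; simp only [mem_inter_iff]; tauto
    rw [hset]
  rw [e3, e4, e5, e6]
  -- signs
  have hα : 0 ≤ α := measureReal_nonneg
  have hγ : 0 ≤ γ := measureReal_nonneg
  have hδ0 : 0 ≤ δ0 := measureReal_nonneg
  have hmcy : 0 ≤ mcy := measureReal_nonneg
  have hmbcy : 0 ≤ mbcy := measureReal_nonneg
  have hmby0 : 0 ≤ mby0 := measureReal_nonneg
  have hmcy_le : mcy ≤ δ0 := measureReal_mono inter_subset_left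
  have hmbcy_le : mbcy ≤ mcy := by
    refine measureReal_mono ?_
    intro ω hω; exact ⟨hω.1, hω.2.2⟩
  -- (B) rewritten: α δ0 ≤ γ mby0
  have hB' : α * δ0 ≤ γ * mby0 := by
    have : α * δ ≤ γ * mbyD := hB
    rw [e1, e2] at this
    nlinarith
  -- main estimate: δ0 · (mcy α) ≤ δ0 · (γ mbcy)
  have hmain : δ0 * (mcy * α) ≤ δ0 * (mbcy * γ) := by
    have h1 : mcy * (α * δ0) ≤ mcy * (γ * mby0) := mul_le_mul_of_nonneg_left hB' hmcy
    have h2 : γ * (mby0 * mcy) ≤ γ * (mbcy * δ0) := mul_le_mul_of_nonneg_left hA hγ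
    nlinarith
  rcases hδ0.eq_or_lt with h0 | hpos
  · -- δ0 = 0 forces mcy = mbcy = 0
    have hmcy0 : mcy = 0 := le_antisymm (h0 ▸ hmcy_le) hmcy
    have hmbcy0 : mbcy = 0 := le_antisymm (hmcy0 ▸ hmbcy_le) hmbcy
    rw [hmcy0, hmbcy0]
    simp
  · have h := le_of_mul_le_mul_left hmain hpos
    nlinarith

/-- **The `c ↔ y` mirror**: `P(a|b|cy) · P(ay|bc) ≤ P(a|bcy) · P(ay|b|c)` (`crossPendant_exchange` with the roles
of `c` and `y` exchanged, the cells `a|b|cy` and `a|bcy` being symmetric). [this work] -/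
theorem crossPendant_exchange' (w : Sym2 V → unitInterval) (a b c y : V) :
    (prodBernoulli w).real ((openConn a b)ᶜ ∩ (openConn a y)ᶜ ∩ (openConn a c)ᶜ ∩ openConn y c ∩
          (openConn b c)ᶜ) *
        (prodBernoulli w).real ((openConn a b)ᶜ ∩ (openConn a c)ᶜ ∩ openConn a y ∩ openConn b c) ≤
      (prodBernoulli w).real ((openConn a b)ᶜ ∩ (openConn a y)ᶜ ∩ (openConn a c)ᶜ ∩ openConn b c ∩
          openConn y c) *
        (prodBernoulli w).real ((openConn a b)ᶜ ∩ (openConn a c)ᶜ ∩ openConn a y ∩ (openConn b c)ᶜ) :=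
  crossPendant_exchange w a b y c

omit [Fintype V] in
/-- The cell `a|b|cy` in its two spellings: `{a≁b,a≁c,a≁y,c~y,b≁y} = {a≁b,a≁y,a≁c,y~c,b≁c}`. [folklore] -/
theorem cell_a_b_cy_eq (a b c y : V) :
    ((openConn a b)ᶜ ∩ (openConn a y)ᶜ ∩ (openConn a c)ᶜ ∩ openConn y c ∩ (openConn b c)ᶜ :
        Set (BondConfig V)) =
      (openConn a b)ᶜ ∩ (openConn a c)ᶜ ∩ (openConn a y)ᶜ ∩ openConn c y ∩ (openConn b y)ᶜ := by
  ext ω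
  simp only [mem_inter_iff, mem_compl_iff, openConn, mem_setOf_eq]
  constructor
  · rintro ⟨⟨⟨⟨h1, h2⟩, h3⟩, h4⟩, h5⟩
    exact ⟨⟨⟨⟨h1, h3⟩, h2⟩, h4.symm⟩, fun h => h5 (h.trans h4)⟩
  · rintro ⟨⟨⟨⟨h1, h2⟩, h3⟩, h4⟩, h5⟩
    exact ⟨⟨⟨⟨h1, h3⟩, h2⟩, h4.symm⟩, fun h => h5 (h.trans h4)⟩

omit [Fintype V] in
/-- The cell `a|bcy` in its two spellings. [folklore] -/
theorem cell_a_bcy_eq (a b c y : V) :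
    ((openConn a b)ᶜ ∩ (openConn a y)ᶜ ∩ (openConn a c)ᶜ ∩ openConn b c ∩ openConn y c :
        Set (BondConfig V)) =
      (openConn a b)ᶜ ∩ (openConn a c)ᶜ ∩ (openConn a y)ᶜ ∩ openConn b y ∩ openConn c y := by
  ext ω
  simp only [mem_inter_iff, mem_compl_iff, openConn, mem_setOf_eq]
  constructor
  · rintro ⟨⟨⟨⟨h1, h2⟩, h3⟩, h4⟩, h5⟩
    exact ⟨⟨⟨⟨h1, h3⟩, h2⟩, h4.trans h5.symm⟩, h5.symm⟩
  · rintro ⟨⟨⟨⟨h1, h2⟩, h3⟩, h4⟩, h5⟩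
    exact ⟨⟨⟨⟨h1, h3⟩, h2⟩, h4.trans h5.symm⟩, h5.symm⟩

/-- **Crossings-to-pendant exchange, summed form** (= concavity of the row `Q44b` along the one-bond pencil of the
edge `{a,b}`, memo §3): `P(a|b|cy) · [P(ac|by) + P(ay|bc)] ≤ P(a|bcy) · [P(ac|b|y) + P(ay|b|c)]` for every finite
weighted graph. [this work] -/
theorem crossPendant_exchange_sum (w : Sym2 V → unitInterval) (a b c y : V) :
    (prodBernoulli w).real ((openConn a b)ᶜ ∩ (openConn a c)ᶜ ∩ (openConn a y)ᶜ ∩ openConn c y ∩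
          (openConn b y)ᶜ) *
        ((prodBernoulli w).real ((openConn a b)ᶜ ∩ (openConn a y)ᶜ ∩ openConn a c ∩ openConn b y) +
          (prodBernoulli w).real ((openConn a b)ᶜ ∩ (openConn a c)ᶜ ∩ openConn a y ∩ openConn b c)) ≤
      (prodBernoulli w).real ((openConn a b)ᶜ ∩ (openConn a c)ᶜ ∩ (openConn a y)ᶜ ∩ openConn b y ∩
          openConn c y) *
        ((prodBernoulli w).real ((openConn a b)ᶜ ∩ (openConn a y)ᶜ ∩ openConn a c ∩ (openConn b y)ᶜ) +
          (prodBernoulli w).real ((openConn a b)ᶜ ∩ (openConn a c)ᶜ ∩ openConn a y ∩ (openConn b c)ᶜ)) := by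
  have h1 := crossPendant_exchange w a b c y
  have h2 := crossPendant_exchange' w a b c y
  rw [cell_a_b_cy_eq, cell_a_bcy_eq] at h2
  nlinarith [h1, h2]

end Q44bExchange

end Summit.CriticalPhenomena.PercolationContinuityZ3.Theorems
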